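import Summits.ValiantsHypothesis.ValiantsHypothesis.Theorems.BarrierLeverAnchoredDoorHitsLowerPairsStarDoor
import Mathlib.Algebra.Polynomial.Roots

/-!
# Route BarrierLever — support item `AnchoredDoorHitsLowerPairs` (stmt-ValiantsHypothesis-22510), line `anchored_peeling`:
# THE VERTEX–FACET COFACTOR CERTIFICATE, part 1 — the gap lemma and the one-parameter family (val-np-p1 g31)

Preliminaries for `…StarCofactor` (memo HOME/val-np-p1/g31/MEMO-trop-valnp1-g31.md §9b). §1 `coeff_prod_gap`: if every factor `f i` of a
product of polynomials has its monomials in degree `top i` or in degrees `≤ top i − gap`, then the coefficient of the product `gap` below the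
top is `Σ_{i*} drop(i*) · ∏_{i ≠ i*} lead(i)`. §2 the family `g = s^{h+1} θ`, `d = s · [x = b][e ∈ T]`: every summand of
the family entry `starEntry g d A S` is a monomial (`family_summand`, `coeff_family_entry`); its monomials have degree `(h+1)|A|` with coefficient
`∏_{b'∈A} Σ_{e∈S} θ` (`family_entry_top`) or degree `≤ (h+1)(|A|−1) + |T|` (`family_entry_shape`), and for `T ≠ ∅` maximal in `S` the coefficient
in degree `(h+1)(|A|−1) + |T|` is `[A = {b}][S = T]` (`family_entry_drop`: only the lone centre `b` carrying the whole facet `T` reaches it).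
Nothing here bears on crux 14610 or on `VP ≠ VNP`.
-/

set_option linter.dupNamespace false

namespace Summit.ValiantsHypothesis.ValiantsHypothesis.Theorems.BarrierLever.AnchoredPeeling

open Finset Polynomial

noncomputable section

namespace StarDoor

variable {h : ℕ}

/-! ## 1. A gap lemma for coefficients of products of polynomials -/

section Gap

variable {K : Type*} [CommRing K] {ι : Type*}

/-- **Gap lemma.** If every polynomial `f i` has its monomials either in degree `top i` or in degrees `≤ top i − gap` (`gap ≥ 1`), then the product
has the same shape with top `Σ top i`, its top coefficient is the product of the top coefficients, and its coefficient `gap` below the top is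
`Σ_{i*} drop(i*) · ∏_{i ≠ i*} lead(i)` (`drop(i) = coeff (top i − gap)`, or `0` when `top i < gap`). -/
theorem coeff_prod_gap [DecidableEq ι] (s : Finset ι) (f : ι → Polynomial K) (top : ι → ℕ) (gap : ℕ) (hgap : 1 ≤ gap)
    (hf : ∀ i ∈ s, ∀ e, (f i).coeff e ≠ 0 → e = top i ∨ e + gap ≤ top i) :
    (∀ e, (∏ i ∈ s, f i).coeff e ≠ 0 → e = ∑ i ∈ s, top i ∨ e + gap ≤ ∑ i ∈ s, top i) ∧
    (∏ i ∈ s, f i).coeff (∑ i ∈ s, top i) = ∏ i ∈ s, (f i).coeff (top i) ∧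
    (gap ≤ ∑ i ∈ s, top i → (∏ i ∈ s, f i).coeff (∑ i ∈ s, top i - gap) =
      ∑ i ∈ s, (if gap ≤ top i then (f i).coeff (top i - gap) else 0) * ∏ i' ∈ s.erase i, (f i').coeff (top i')) := by
  induction s using Finset.induction_on with
  | empty =>
    refine ⟨?_, ?_, ?_⟩
    · intro e he
      left
      simp only [Finset.prod_empty, Polynomial.coeff_one] at he
      simp only [Finset.sum_empty]
      by_contra hne; exact he (if_neg hne)
    · simp
    · intro hle
      simp only [Finset.sum_empty, nonpos_iff_eq_zero] at hle
      omega
  | insert a s ha ih =>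
    have hfs : ∀ i ∈ s, ∀ e, (f i).coeff e ≠ 0 → e = top i ∨ e + gap ≤ top i := fun i hi => hf i (Finset.mem_insert_of_mem hi)
    have hfa : ∀ e, (f a).coeff e ≠ 0 → e = top a ∨ e + gap ≤ top a := hf a (Finset.mem_insert_self a s)
    obtain ⟨ihgap, ihtop, ihdrop⟩ := ih hfs
    set Q := ∏ i ∈ s, f i with hQ
    set Ts := ∑ i ∈ s, top i with hTs
    rw [Finset.prod_insert ha, Finset.sum_insert ha]
    refine ⟨?_, ?_, ?_⟩
    · -- shape of the product
      intro e he
      rw [Polynomial.coeff_mul] at he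
      obtain ⟨x, hx, hxne⟩ := Finset.exists_ne_zero_of_sum_ne_zero he
      have hx1 : (f a).coeff x.1 ≠ 0 := fun h0 => hxne (by rw [h0, zero_mul])
      have hx2 : Q.coeff x.2 ≠ 0 := fun h0 => hxne (by rw [h0, mul_zero])
      have hsum : x.1 + x.2 = e := Finset.HasAntidiagonal.mem_antidiagonal.mp hx
      rcases hfa x.1 hx1 with h1 | h1 <;> rcases ihgap x.2 hx2 with h2 | h2 <;> omega
    · -- top coefficient
      rw [Polynomial.coeff_mul, Finset.sum_eq_single (top a, Ts)]
      · show (f a).coeff (top a) * Q.coeff Ts = _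
        rw [ihtop, Finset.prod_insert ha]
      · intro x hx hne
        have hsum : x.1 + x.2 = top a + Ts := Finset.HasAntidiagonal.mem_antidiagonal.mp hx
        by_cases h1 : (f a).coeff x.1 = 0
        · rw [h1, zero_mul]
        by_cases h2 : Q.coeff x.2 = 0
        · rw [h2, mul_zero]
        exfalso
        rcases hfa x.1 h1 with e1 | e1 <;> rcases ihgap x.2 h2 with e2 | e2
        · exact hne (Prod.ext e1 e2)
        all_goals omega
      · intro hnot
        exact (hnot (Finset.HasAntidiagonal.mem_antidiagonal.mpr rfl)).elim
    · -- the coefficient `gap` below the top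
      intro hle
      rw [Polynomial.coeff_mul, Finset.sum_insert ha, Finset.erase_insert ha]
      have hterm : ∀ x : ℕ × ℕ, x.1 + x.2 = top a + Ts - gap → (f a).coeff x.1 * Q.coeff x.2 ≠ 0 →
          (x = (top a, Ts - gap) ∧ gap ≤ Ts) ∨ (x = (top a - gap, Ts) ∧ gap ≤ top a) := by
        intro x hsum hne
        have h1 : (f a).coeff x.1 ≠ 0 := fun h0 => hne (by rw [h0, zero_mul])
        have h2 : Q.coeff x.2 ≠ 0 := fun h0 => hne (by rw [h0, mul_zero])
        rcases hfa x.1 h1 with e1 | e1 <;> rcases ihgap x.2 h2 with e2 | e2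
        · exfalso; omega
        · left; refine ⟨Prod.ext e1 ?_, by omega⟩; show x.2 = Ts - gap; omega
        · right; refine ⟨Prod.ext ?_ e2, by omega⟩; show x.1 = top a - gap; omega
        · exfalso; omega
      have hrest : ∑ i ∈ s, (if gap ≤ top i then (f i).coeff (top i - gap) else 0) * ∏ i' ∈ (insert a s).erase i, (f i').coeff (top i')
          = (f a).coeff (top a) * ∑ i ∈ s, (if gap ≤ top i then (f i).coeff (top i - gap) else 0) * ∏ i' ∈ s.erase i, (f i').coeff (top i') := by
        rw [Finset.mul_sum]
        refine Finset.sum_congr rfl fun i hi => ?_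
        rw [Finset.erase_insert_of_ne (ne_of_mem_of_not_mem hi ha).symm,
          Finset.prod_insert (fun h' => ha (Finset.mem_of_mem_erase h'))]
        ring
      rw [hrest]
      have hsmall : ¬ gap ≤ Ts → ∑ i ∈ s, (if gap ≤ top i then (f i).coeff (top i - gap) else 0) * ∏ i' ∈ s.erase i, (f i').coeff (top i') = 0 := by
        intro hgs
        refine Finset.sum_eq_zero fun i hi => ?_
        have hti : top i ≤ Ts := by rw [hTs]; exact Finset.single_le_sum (fun _ _ => Nat.zero_le _) hi
        rw [if_neg (by omega), zero_mul]
      by_cases hga : gap ≤ top a <;> by_cases hgs : gap ≤ Ts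
      · -- two genuine contributions
        have hne12 : ((top a, Ts - gap) : ℕ × ℕ) ≠ (top a - gap, Ts) := by
          intro h12; have := congr_arg Prod.fst h12; simp only at this; omega
        rw [Finset.sum_eq_add_of_mem (top a, Ts - gap) (top a - gap, Ts)
          (Finset.HasAntidiagonal.mem_antidiagonal.mpr (show top a + (Ts - gap) = top a + Ts - gap by omega))
          (Finset.HasAntidiagonal.mem_antidiagonal.mpr (show (top a - gap) + Ts = top a + Ts - gap by omega)) hne12]
        · show (f a).coeff (top a) * Q.coeff (Ts - gap) + (f a).coeff (top a - gap) * Q.coeff Ts = _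
          rw [ihdrop hgs, ihtop]
          simp only [if_pos hga]
          ring
        · intro x hx hne
          by_contra hne0
          rcases hterm x (Finset.HasAntidiagonal.mem_antidiagonal.mp hx) hne0 with ⟨h1, -⟩ | ⟨h1, -⟩
          · exact hne.1 h1
          · exact hne.2 h1
      · -- only `(top a - gap, Ts)`
        rw [Finset.sum_eq_single (top a - gap, Ts)]
        · show (f a).coeff (top a - gap) * Q.coeff Ts = _
          rw [ihtop, hsmall hgs, mul_zero, add_zero, if_pos hga]
        · intro x hx hne
          by_contra hne0
          rcases hterm x (Finset.HasAntidiagonal.mem_antidiagonal.mp hx) hne0 with ⟨-, h2⟩ | ⟨h1, -⟩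
          · exact hgs h2
          · exact hne h1
        · intro hnot
          exact (hnot (Finset.HasAntidiagonal.mem_antidiagonal.mpr
            (show (top a - gap) + Ts = top a + Ts - gap by omega))).elim
      · -- only `(top a, Ts - gap)`
        rw [Finset.sum_eq_single (top a, Ts - gap)]
        · show (f a).coeff (top a) * Q.coeff (Ts - gap) = _
          rw [ihdrop hgs, if_neg hga, zero_mul, zero_add]
        · intro x hx hne
          by_contra hne0
          rcases hterm x (Finset.HasAntidiagonal.mem_antidiagonal.mp hx) hne0 with ⟨h1, -⟩ | ⟨-, h2⟩
          · exact hne h1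
          · exact hga h2
        · intro hnot
          exact (hnot (Finset.HasAntidiagonal.mem_antidiagonal.mpr
            (show top a + (Ts - gap) = top a + Ts - gap by omega))).elim
      · -- no contribution at all
        rw [Finset.sum_eq_zero, hsmall hgs, mul_zero, add_zero]
        · rw [if_neg hga, zero_mul]
        · intro x hx
          by_contra hne0
          rcases hterm x (Finset.HasAntidiagonal.mem_antidiagonal.mp hx) hne0 with ⟨-, h2⟩ | ⟨-, h2⟩
          · exact hgs h2
          · exact hga h2

end Gap

/-! ## 2. The one-parameter family and its entries -/

section Family

variable (θ : Fin h → Fin h → ℂ) (b : Fin h) (T : Finset (Fin h))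

/-! The family: row weights `g = s^{h+1} · θ` (all row-leaf edges scaled by `s^{h+1}`), column-leaf weights `d = s` on `{b} × T` and `0`
elsewhere; written out as lambdas below. -/

/-- The summand of the family entry at `(A', S')` is a monomial:
`C(∏_{b'∈A∖A'} Σ_{e∈S'} θ) · s^{(h+1)|A∖A'| + |S∖S'|}` when (`b ∈ A'` and `S ∖ S' ⊆ T`) or `S ∖ S' = ∅`, and `0` otherwise. -/
theorem family_summand (A S A' S' : Finset (Fin h)) :
    (∏ b' ∈ A \ A', ∑ e ∈ S', (fun b' e => (X : Polynomial ℂ) ^ (h + 1) * C (θ b' e)) b' e) * (∏ e ∈ S \ S', ∑ x ∈ A', (fun x e => if x = b ∧ e ∈ T then (X : Polynomial ℂ) else 0) x e)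
      = if (∀ e ∈ S \ S', b ∈ A' ∧ e ∈ T) then
          C (∏ b' ∈ A \ A', ∑ e ∈ S', θ b' e) * X ^ ((h + 1) * (A \ A').card + (S \ S').card) else 0 := by
  classical
  have h1 : (∏ b' ∈ A \ A', ∑ e ∈ S', (fun b' e => (X : Polynomial ℂ) ^ (h + 1) * C (θ b' e)) b' e) = C (∏ b' ∈ A \ A', ∑ e ∈ S', θ b' e) * X ^ ((h + 1) * (A \ A').card) := by
    rw [map_prod]
    have : ∀ b' ∈ A \ A', (∑ e ∈ S', (X : Polynomial ℂ) ^ (h + 1) * C (θ b' e)) = X ^ (h + 1) * C (∑ e ∈ S', θ b' e) := by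
      intro b' _
      rw [map_sum, Finset.mul_sum]
    rw [Finset.prod_congr rfl this, Finset.prod_mul_distrib, Finset.prod_const, ← pow_mul, mul_comm]
  have h2 : ∀ e, (∑ x ∈ A', (fun x e => if x = b ∧ e ∈ T then (X : Polynomial ℂ) else 0) x e) = if b ∈ A' ∧ e ∈ T then (X : Polynomial ℂ) else 0 := by
    intro e
    by_cases hb : b ∈ A'
    · rw [Finset.sum_eq_single b]
      · simp [hb]
      · intro x _ hxb; simp [hxb]
      · intro hnb; exact (hnb hb).elim
    · rw [if_neg (fun h' => hb h'.1)]
      exact Finset.sum_eq_zero fun x hx => by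
        have : x ≠ b := fun h' => hb (h' ▸ hx)
        simp [this]
  rw [h1, Finset.prod_congr rfl fun e _ => h2 e]
  by_cases hall : ∀ e ∈ S \ S', b ∈ A' ∧ e ∈ T
  · rw [if_pos hall, Finset.prod_congr rfl fun e he => if_pos (hall e he), Finset.prod_const, pow_add, mul_assoc]
  · rw [if_neg hall]
    push Not at hall
    obtain ⟨e, he, hne⟩ := hall
    rw [Finset.prod_eq_zero he (if_neg (fun h' => hne h'.1 h'.2)), mul_zero]

/-- Coefficient formula for the family entry: its `n`-th coefficient is the sum over the admissible `(A', S')` whose monomial degree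
`(h+1)|A∖A'| + |S∖S'|` is `n`. -/
theorem coeff_family_entry (A S : Finset (Fin h)) (n : ℕ) :
    (starEntry (fun b' e => (X : Polynomial ℂ) ^ (h + 1) * C (θ b' e)) (fun x e => if x = b ∧ e ∈ T then (X : Polynomial ℂ) else 0) A S).coeff n = ∑ A' ∈ A.powerset, ∑ S' ∈ S.powerset,
      if (∀ e ∈ S \ S', b ∈ A' ∧ e ∈ T) ∧ n = (h + 1) * (A \ A').card + (S \ S').card then ∏ b' ∈ A \ A', ∑ e ∈ S', θ b' e else 0 := by
  classical
  unfold starEntry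
  rw [Polynomial.finsetSum_coeff]
  refine Finset.sum_congr rfl fun A' _ => ?_
  rw [Polynomial.finsetSum_coeff]
  refine Finset.sum_congr rfl fun S' _ => ?_
  rw [family_summand]
  by_cases hc : ∀ e ∈ S \ S', b ∈ A' ∧ e ∈ T
  · rw [if_pos hc, Polynomial.coeff_C_mul_X_pow]
    by_cases hn : n = (h + 1) * (A \ A').card + (S \ S').card
    · rw [if_pos hn, if_pos ⟨hc, hn⟩]
    · rw [if_neg hn, if_neg (fun h' => hn h'.2)]
  · rw [if_neg hc, Polynomial.coeff_zero, if_neg (fun h' => hc h'.1)]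

/-- SHAPE of the family entry: every monomial has degree `(h+1)|A|` or degree `≤ (h+1)(|A| − 1) + |T|`. -/
theorem family_entry_shape (A S : Finset (Fin h)) (n : ℕ) (hn : (starEntry (fun b' e => (X : Polynomial ℂ) ^ (h + 1) * C (θ b' e)) (fun x e => if x = b ∧ e ∈ T then (X : Polynomial ℂ) else 0) A S).coeff n ≠ 0) :
    n = (h + 1) * A.card ∨ n + ((h + 1) - T.card) ≤ (h + 1) * A.card := by
  classical
  rw [coeff_family_entry] at hn
  obtain ⟨A', hA', hne⟩ := Finset.exists_ne_zero_of_sum_ne_zero hn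
  obtain ⟨S', hS', hne'⟩ := Finset.exists_ne_zero_of_sum_ne_zero hne
  have hA'A : A' ⊆ A := Finset.mem_powerset.mp hA'
  have hS'S : S' ⊆ S := Finset.mem_powerset.mp hS'
  by_cases hc : (∀ e ∈ S \ S', b ∈ A' ∧ e ∈ T) ∧ n = (h + 1) * (A \ A').card + (S \ S').card
  · obtain ⟨hall, hn'⟩ := hc
    have hcardA : (A \ A').card = A.card - A'.card := Finset.card_sdiff_of_subset hA'A
    have hA'le : A'.card ≤ A.card := Finset.card_le_card hA'A
    have hTh : T.card ≤ h := by simpa using Finset.card_le_univ T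
    by_cases hA'e : A' = ∅
    · -- then `S \ S'` must be empty
      have hSS : (S \ S').card = 0 := by
        rw [Finset.card_eq_zero, Finset.sdiff_eq_empty_iff_subset]
        intro e he
        by_contra heS'
        have := (hall e (Finset.mem_sdiff.mpr ⟨he, heS'⟩)).1
        rw [hA'e] at this
        exact Finset.notMem_empty b this
      left
      rw [hn', hSS, hcardA, hA'e, Finset.card_empty]
      simp
    · right
      have hA'pos : 1 ≤ A'.card := Finset.card_pos.mpr (Finset.nonempty_iff_ne_empty.mpr hA'e)
      have hST : (S \ S').card ≤ T.card := by
        apply Finset.card_le_card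
        intro e he
        exact (hall e he).2
      rw [hn', hcardA]
      have : (h + 1) * (A.card - A'.card) + (h + 1) ≤ (h + 1) * A.card := by
        rw [← Nat.mul_succ]
        exact Nat.mul_le_mul_left _ (by omega)
      omega
  · exact (hne' (if_neg hc)).elim

/-- TOP coefficient of the family entry: `coeff ((h+1)|A|) = ∏_{b'∈A} Σ_{e∈S} θ` (all row vertices leaves). -/
theorem family_entry_top (A S : Finset (Fin h)) :
    (starEntry (fun b' e => (X : Polynomial ℂ) ^ (h + 1) * C (θ b' e)) (fun x e => if x = b ∧ e ∈ T then (X : Polynomial ℂ) else 0) A S).coeff ((h + 1) * A.card) = ∏ b' ∈ A, ∑ e ∈ S, θ b' e := by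
  classical
  rw [coeff_family_entry, Finset.sum_eq_single_of_mem ∅ (Finset.empty_mem_powerset A),
    Finset.sum_eq_single_of_mem S (Finset.mem_powerset.mpr (subset_refl S))]
  · simp
  · intro S' hS' hne
    rw [if_neg]
    rintro ⟨hall, hn⟩
    have hS'S : S' ⊆ S := Finset.mem_powerset.mp hS'
    obtain ⟨e, he⟩ : (S \ S').Nonempty := by
      rw [Finset.sdiff_nonempty]; exact fun hSS' => hne (subset_antisymm hS'S hSS')
    exact Finset.notMem_empty b (hall e he).1
  · intro A' hA' hne
    refine Finset.sum_eq_zero fun S' hS' => if_neg ?_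
    rintro ⟨hall, hn⟩
    have hA'A : A' ⊆ A := Finset.mem_powerset.mp hA'
    have hTh : T.card ≤ h := by simpa using Finset.card_le_univ T
    have hcardA : (A \ A').card = A.card - A'.card := Finset.card_sdiff_of_subset hA'A
    have hA'pos : 1 ≤ A'.card := Finset.card_pos.mpr (Finset.nonempty_iff_ne_empty.mpr hne)
    have hA'le : A'.card ≤ A.card := Finset.card_le_card hA'A
    have hST : (S \ S').card ≤ T.card := Finset.card_le_card fun e he => (hall e he).2
    rw [hcardA] at hn
    have : (h + 1) * (A.card - A'.card) + (h + 1) ≤ (h + 1) * A.card := by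
      rw [← Nat.mul_succ]; exact Nat.mul_le_mul_left _ (by omega)
    omega

/-- DROP coefficient of the family entry: for nonempty `A` and `T` nonempty and ⊆-maximal with respect to `S` (`T ⊆ S → S = T`), the coefficient in
degree `(h+1)(|A| − 1) + |T|` is `1` if `(A, S) = ({b}, T)` and `0` otherwise. -/
theorem family_entry_drop (A S : Finset (Fin h)) (hA : A.Nonempty) (hT : T.Nonempty) (hmax : T ⊆ S → S = T) :
    (starEntry (fun b' e => (X : Polynomial ℂ) ^ (h + 1) * C (θ b' e)) (fun x e => if x = b ∧ e ∈ T then (X : Polynomial ℂ) else 0) A S).coeff ((h + 1) * (A.card - 1) + T.card) = if A = {b} ∧ S = T then 1 else 0 := by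
  classical
  rw [coeff_family_entry]
  have hTh : T.card ≤ h := by simpa using Finset.card_le_univ T
  have hTpos : 1 ≤ T.card := Finset.card_pos.mpr hT
  have hApos : 1 ≤ A.card := Finset.card_pos.mpr hA
  -- the only admissible summand is `(A', S') = ({b}, ∅)` with `A = {b}`, `S = T`
  have key : ∀ A' ∈ A.powerset, ∀ S' ∈ S.powerset,
      ((∀ e ∈ S \ S', b ∈ A' ∧ e ∈ T) ∧ (h + 1) * (A.card - 1) + T.card = (h + 1) * (A \ A').card + (S \ S').card) →
      A' = {b} ∧ S' = ∅ ∧ S = T := by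
    intro A' hA' S' hS' ⟨hall, hn⟩
    have hA'A : A' ⊆ A := Finset.mem_powerset.mp hA'
    have hS'S : S' ⊆ S := Finset.mem_powerset.mp hS'
    have hcardA : (A \ A').card = A.card - A'.card := Finset.card_sdiff_of_subset hA'A
    have hA'le : A'.card ≤ A.card := Finset.card_le_card hA'A
    have hSTsub : S \ S' ⊆ T := fun e he => (hall e he).2
    have hST : (S \ S').card ≤ T.card := Finset.card_le_card hSTsub
    rw [hcardA] at hn
    -- degree comparison forces |A'| = 1 and |S \ S'| = |T|
    have hA'1 : A'.card = 1 := by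
      by_contra hne1
      rcases Nat.lt_or_gt_of_ne hne1 with hlt | hgt
      · -- A' = ∅ : then S \ S' = ∅, contradiction with T.card ≥ 1
        have hA'0 : A'.card = 0 := by omega
        have hA'e : A' = ∅ := Finset.card_eq_zero.mp hA'0
        have hSS : (S \ S').card = 0 := by
          rw [Finset.card_eq_zero, Finset.sdiff_eq_empty_iff_subset]
          intro e he; by_contra heS'
          have := (hall e (Finset.mem_sdiff.mpr ⟨he, heS'⟩)).1
          rw [hA'e] at this; exact Finset.notMem_empty b this
        rw [hA'0, hSS] at hn
        simp only [Nat.sub_zero, add_zero] at hn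
        have : (h + 1) * (A.card - 1) + (h + 1) = (h + 1) * A.card := by
          rw [← Nat.mul_succ]; congr 1; omega
        omega
      · have : (h + 1) * (A.card - A'.card) + (h + 1) ≤ (h + 1) * (A.card - 1) := by
          rw [← Nat.mul_succ]; exact Nat.mul_le_mul_left _ (by omega)
        omega
    have hSS' : (S \ S').card = T.card := by rw [hA'1] at hn; omega
    have hSdiff : S \ S' = T := Finset.eq_of_subset_of_card_le hSTsub (by rw [hSS'])
    have hTS : T ⊆ S := hSdiff ▸ Finset.sdiff_subset
    have hSeq : S = T := hmax hTS
    have hS'e : S' = ∅ := by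
      have : S' ⊆ S \ (S \ S') := fun e he => Finset.mem_sdiff.mpr ⟨hS'S he, fun h' => (Finset.mem_sdiff.mp h').2 he⟩
      rw [hSdiff, hSeq, Finset.sdiff_self] at this
      exact Finset.subset_empty.mp this
    -- b ∈ A' (from some e ∈ S \ S' = T, nonempty) and |A'| = 1
    obtain ⟨e, he⟩ := hT
    have hbA' : b ∈ A' := (hall e (by rw [hSdiff]; exact he)).1
    obtain ⟨x, hx⟩ := Finset.card_eq_one.mp hA'1
    rw [hx] at hbA'
    have : x = b := (Finset.mem_singleton.mp hbA').symm
    exact ⟨by rw [hx, this], hS'e, hSeq⟩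
  by_cases hST : S = T
  · by_cases hbA : b ∈ A
    · have hbP : ({b} : Finset (Fin h)) ∈ A.powerset := Finset.mem_powerset.mpr (Finset.singleton_subset_iff.mpr hbA)
      rw [Finset.sum_eq_single_of_mem {b} hbP]
      · rw [Finset.sum_eq_single_of_mem ∅ (Finset.empty_mem_powerset S)]
        · rw [if_pos]
          · -- the value `∏_{b' ∈ A ∖ {b}} Σ_{e ∈ ∅} θ` is `[A = {b}]`
            simp only [Finset.sum_empty, hST, and_true]
            by_cases hAb : A = {b}
            · rw [if_pos hAb, hAb]; simp
            · rw [if_neg hAb]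
              obtain ⟨x, hx⟩ : (A \ {b}).Nonempty := by
                rw [Finset.sdiff_nonempty]
                intro hsub
                exact hAb (subset_antisymm hsub (Finset.singleton_subset_iff.mpr hbA))
              exact Finset.prod_eq_zero hx rfl
          · refine ⟨fun e he => ⟨Finset.mem_singleton_self b, ?_⟩, ?_⟩
            · rw [hST] at he; simpa using he
            · rw [hST, Finset.sdiff_empty, Finset.card_sdiff_of_subset (Finset.singleton_subset_iff.mpr hbA), Finset.card_singleton]
        · intro S' hS' hne
          exact if_neg fun hc => hne (key {b} hbP S' hS' hc).2.1
      · intro A' hA' hne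
        exact Finset.sum_eq_zero fun S' hS' => if_neg fun hc => hne (key A' hA' S' hS' hc).1
    · rw [if_neg (fun hc => hbA (by rw [hc.1]; exact Finset.mem_singleton_self b))]
      refine Finset.sum_eq_zero fun A' hA' => Finset.sum_eq_zero fun S' hS' => if_neg fun hc => hbA ?_
      have hA'b := (key A' hA' S' hS' hc).1
      have hA'A : A' ⊆ A := Finset.mem_powerset.mp hA'
      exact hA'A (by rw [hA'b]; exact Finset.mem_singleton_self b)
  · rw [if_neg (fun hc => hST hc.2)]
    exact Finset.sum_eq_zero fun A' hA' => Finset.sum_eq_zero fun S' hS' => if_neg fun hc => hST (key A' hA' S' hS' hc).2.2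

end Family

end StarDoor

end

end Summit.ValiantsHypothesis.ValiantsHypothesis.Theorems.BarrierLever.AnchoredPeeling
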